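import Summits.BirchSwinnertonDyer.Rank1Residual.WAll.ConjunctionGrossZagier
import Summits.BirchSwinnertonDyer.Rank1Residual.WAll.TargetAtTwoThetaSlices
import Summits.BirchSwinnertonDyer.Rank1Residual.WAll.TargetAdditiveFiveLeSharpSlices
import Summits.BirchSwinnertonDyer.Rank1Residual.WAll.TargetAdditiveAtThreeWildTwinSlices
import Summits.BirchSwinnertonDyer.Rank1Residual.WAll.TargetX1Slices
import HarnessLib
import HarnessLib.Audit.Tags

/-!
# Rung W-ALL of ladder BSD (D-0120) — the closed list READ THROUGH THE LIVE LANE-3 ROUTES: W-ALL from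
# the five attacked cells (TPT / AKR / UTD / SBC / BED targets BY NAME), the named residual leaves, and
# the fifteen print facts of `wAll_of_exclusions_primaryGZ` (cell `bsd-wall`, lane (2) reassembly,
# seat `bsd-wall-ty-1`; theorems only, no new statement)

HONEST FRAMING (cell `bsd-wall`, run/shared/lean/pub/bsd-wall/; brief `WALL-BRIEF-v1.md` sha16
b966bf16da27706e §2 «the conjunction is kernel-tracked at sub-class granularity»): BOOKKEEPING ONLY —
nothing asserted, nothing booked, no named fact, no published theorem restated. Every hypothesis
below is either a registered `@[conjecture]` leaf of the W-ALL books (OPEN unless a route closes it)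
or one of the fifteen named print facts ALREADY consumed by `wAll_of_exclusions_primaryGZ`
(`ConjunctionGrossZagier.lean` §2). The theorem says exactly which named statements remain between
the five live routes and rung W-ALL — the repair census in Lean — and nothing more.

THE LIVE ROUTES (2026-08-27, `ledger route show`): `ThetaPartnerAtTwo` (TPT, row 1; attacked cell =
`WAllNonCMAtTwoThetaHabitat`, residual item 20334 = `WAllNonCMAtTwoOffThetaHabitat`) ·
`AdditiveKolyvaginRoad` (AKR, row 2; attacked cell = `WAllExclAdditiveFiveLeRankOneSharp`, residual
items 20133 / 20134 / 20135 = `WAllExclAdditiveFiveLeRankZero` / `WAllExclAdditiveFiveLeRankOneOffSharp`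
/ `WAllExclAdditiveAtThree`) · `UniversalToricDescent` (UTD, row 2 at `3` wild r1; attacked cell =
`WAllExclAddWildRankOneSurjTwin`, residual items 20388 / 20387 = `WAllExclAddWildRankOneOffSurjTwin` /
`WAllExclAddWildRankZero`) · `SignedBaseChange` (SBC, row 7; target = the slice `WAllCornerX7FiveLe`,
aside 20251 = `WAllCornerX7AtThree`) · `BiquadraticEisensteinDescent` (BED, row 12·K12i; target =
`WAllCornerFInertBad`, read here as `WAllCornerFInertBadFiveLe` ∧ its declared residual R₃ ⇒
`WAllCornerFInertBadAtThree`). All identities «route item = leaf» are `rfl` (scratch-checked by the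
typing seat against the Theses files; recorded in HOME `bsd-wall-ty-1/LEAF-FQNS.md`).

* `wAllExclusions_of_liveRouteLeaves` — the closed list `WAllExclusions` from THIRTY-ONE named leaves:
  the five attacked cells, their named residual atoms (row 2 at `3` read through the K1 cells
  (M)/(G-ord), the rank-`0` potentially supersingular block — which contains UTD's residual
  `WAllExclAddWildRankZero` — the tame rank-one leaf and UTD's three residual atoms twinless /
  normaliser / reducible; row 2 at `p ≥ 5` through the rank-`0` slice and AKR's ♯ / off-♯), row 3
  as X11b ∧ X2c, row 4 as the X1 slices (balanced / unbalanced / rank one), rows 5, 6, 8–11 whole,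
  row 7 and row 12·K12i by prime (`3` / `≥ 5`), row 12·K12₂ and 12·K12r whole. Pure composition of
  the landed `_iff_` glue; EXACT in the sense that `WAll` gives every hypothesis back
  (`liveRouteLeaves_of_wAll`).
* `wAll_of_liveRouteLeaves_primaryGZ` — the same ⇒ `WAll`, through `wAll_of_exclusions_primaryGZ`
  and its FIFTEEN named facts `hSk hBCS hJSW hCGS hGV hGr hmodP hWa hMM hGZ hKo hCM hKob hYZ hLLT`
  (31 + 15 = 46 named hypotheses; neither `rank_eq_analyticRank_of_analyticRank_le_one` nor
  `gross_zagier_rank_one_rat` among them).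
* `wAllFormula_of_liveRouteLeaves_primaryGZ` — the leading-term reading, + `hL0`.
* `liveRouteLeaves_of_wAll` — conversely every one of the 31 leaves is an instance of `WAll`.

References: `WAll/ConjunctionGrossZagier.lean` (§2), `WAll/Conjunction.lean` (`wAllCornerF_iff`,
`wAllExclMultRankOne_iff`), `WAll/TargetPrimeSlices.lean`, `WAll/TargetX1Slices.lean`,
`WAll/TargetAtTwoThetaSlices.lean`, `WAll/TargetAdditiveFiveLeSharpSlices.lean`,
`WAll/TargetAdditiveAtThreeWildTwinSlices.lean` (+ its imports …PotSSIrrAtoms / …PotSSImage /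
…PotSS / …AtThreeCells); HOME `WALL-TABLE.md` v1.12, `bsd-wall-ty-1/LEAF-FQNS.md`; [cite: Darmon2004,
Thm. 3.22 and §3.9] (the Gross–Zagier–Kolyvagin road the fifteen facts feed); [cite: Miller2011LMS,
§1 and Def. 1.1] (the currency `BSD(E,p)`).
-/

noncomputable section

open scoped Classical

open WeierstrassCurve Literature.NumberTheory.EllipticCurves
  Literature.NumberTheory.EllipticCurves.Rank1Residual
  Literature.NumberTheory.EllipticCurves.ModularForms
open Summit.BirchSwinnertonDyer.Rank1Residual
open Summit.BirchSwinnertonDyer.BirchSwinnertonDyer.Rank1Residual (NonCMAtTwo)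

set_option autoImplicit false

namespace Summit.BirchSwinnertonDyer

/-! ### §1. The closed list from the live routes' targets and the named residual leaves -/

/-- **The closed list `WAllExclusions` from the five attacked cells and the named residual leaves**
(31 named hypotheses; pure composition of landed `_iff_` glue). Row by row: 1 = TPT habitat ∧
off-habitat; 2 = [(M)@3, (G-ord)@3, pot-ss r0 @3, tame r1 @3, UTD twin cell, twinless, normaliser,
reducible] ∧ [r0 @≥5, AKR ♯, off-♯]; 3 = X11b ∧ X2c; 4 = X1 balanced ∧ unbalanced ∧ rank one;
5, 6, 8, 9, 10, 11 whole; 7 = @3 ∧ SBC's @≥5; 12 = K12₂ ∧ K12r ∧ (K12i @3 ∧ BED's @≥5).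
[folklore] -/
theorem wAllExclusions_of_liveRouteLeaves
    -- row 1: TPT
    (h1H : WAllNonCMAtTwoThetaHabitat) (h1O : WAllNonCMAtTwoOffThetaHabitat)
    -- row 2 at 3: K1 cells, pot-ss rank-0 block, tame rank one, UTD cell + residual atoms
    (hM3 : WAllExclAddPotMultAtThree) (hG3 : WAllExclAddPotOrdAtThree)
    (hS30 : WAllExclAddPotSSAtThreeRankZero) (hT31 : WAllExclAddTameSSAtThreeRankOne)
    (h2T : WAllExclAddWildRankOneSurjTwin) (h2L : WAllExclAddWildRankOneSurjTwinless)
    (h2N : WAllExclAddWildRankOneIrrNotSurj) (h2R : WAllExclAddWildRankOneRed)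
    -- row 2 at p ≥ 5: rank-0 slice, AKR cell + residual
    (h50 : WAllExclAdditiveFiveLeRankZero) (h5S : WAllExclAdditiveFiveLeRankOneSharp)
    (h5O : WAllExclAdditiveFiveLeRankOneOffSharp)
    -- row 3
    (h3b : WAllExclX11b) (h3c : WAllExclX2RankOne)
    -- row 4 (X1 slices) and rows 5, 6
    (h4B : WAllCornerX1RankZeroBalanced) (h4U : WAllCornerX1RankZeroUnbalanced)
    (h41 : X1.RankOne.Statement) (h5 : WAllCornerX2) (h6 : WAllCornerX6r0)
    -- row 7: p = 3 slice, SBC target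
    (h73 : WAllCornerX7AtThree) (h75 : WAllCornerX7FiveLe)
    -- rows 8–11
    (h8 : WAllCornerX8) (h9 : WAllCornerX9) (h10 : WAllCornerX10b) (h11 : WAllCornerX11a)
    -- row 12: K12₂, K12r, K12i at 3, BED target
    (hF2 : WAllCornerFTwo) (hFr : WAllCornerFRamified) (hF3 : WAllCornerFInertBadAtThree)
    (hF5 : WAllCornerFInertBadFiveLe) : WAllExclusions :=
  ⟨nonCMAtTwo_of_thetaHabitat_of_offThetaHabitat h1H h1O,
    wAllExclAdditive_of_atThree_of_fiveLeRankZero_of_sharp_of_offSharp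
      (wAllExclAdditiveAtThree_of_k1Cells_of_potSSRankZero_of_tame_of_twinAtoms hM3 hG3 hS30 hT31
        h2T h2L h2N h2R)
      h50 h5S h5O,
    wAllExclMultRankOne_iff.2 ⟨h3b, h3c⟩,
    wAllCornerX1_iff_x1Slices.2 ⟨h4B, h4U, h41⟩, h5, h6,
    wAllCornerX7_iff_three_fiveLe.2 ⟨h73, h75⟩, h8, h9, h10, h11,
    wAllCornerF_iff.2 ⟨hF2, hFr, wAllCornerFInertBad_iff_three_fiveLe.2 ⟨hF3, hF5⟩⟩⟩

/-- Conversely every one of the 31 leaves is an instance of `WAll` (so the reading is EXACT).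
[folklore] -/
theorem liveRouteLeaves_of_wAll (h : WAll) :
    (WAllNonCMAtTwoThetaHabitat ∧ WAllNonCMAtTwoOffThetaHabitat) ∧
    (WAllExclAddPotMultAtThree ∧ WAllExclAddPotOrdAtThree ∧ WAllExclAddPotSSAtThreeRankZero ∧
      WAllExclAddTameSSAtThreeRankOne ∧ WAllExclAddWildRankOneSurjTwin ∧
      WAllExclAddWildRankOneSurjTwinless ∧ WAllExclAddWildRankOneIrrNotSurj ∧
      WAllExclAddWildRankOneRed) ∧
    (WAllExclAdditiveFiveLeRankZero ∧ WAllExclAdditiveFiveLeRankOneSharp ∧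
      WAllExclAdditiveFiveLeRankOneOffSharp) ∧
    (WAllExclX11b ∧ WAllExclX2RankOne) ∧
    (WAllCornerX1RankZeroBalanced ∧ WAllCornerX1RankZeroUnbalanced ∧ X1.RankOne.Statement) ∧
    (WAllCornerX2 ∧ WAllCornerX6r0) ∧
    (WAllCornerX7AtThree ∧ WAllCornerX7FiveLe) ∧
    (WAllCornerX8 ∧ WAllCornerX9 ∧ WAllCornerX10b ∧ WAllCornerX11a) ∧
    (WAllCornerFTwo ∧ WAllCornerFRamified ∧ WAllCornerFInertBadAtThree ∧
      WAllCornerFInertBadFiveLe) := by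
  obtain ⟨h1, h2, h3, h4, h5, h6, h7, h8, h9, h10, h11, hF⟩ := wAllExclusions_of_wAll h
  have hcells := cellsAtThree_of_wAll h
  have hps := (primeSlices_of_wAll h).1
  obtain ⟨hF2, hFr, hFi⟩ := wAllCornerF_iff.1 hF
  refine ⟨thetaSlices_of_wAll h, ?_, ?_, wAllExclMultRankOne_iff.1 h3,
    wAllCornerX1_iff_x1Slices.1 h4, ⟨h5, h6⟩, wAllCornerX7_iff_three_fiveLe.1 h7,
    ⟨h8, h9, h10, h11⟩, ⟨hF2, hFr, wAllCornerFInertBad_iff_three_fiveLe.1 hFi⟩⟩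
  · obtain ⟨hT, -, hL⟩ := twinSlices_of_wAll h
    have hat := (atoms_of_wAllExclAddPotSSAtThreeRankOne (potSSAtThree_of_wAll h).2.2).2
    exact ⟨hcells.1.1, hcells.1.2.1, (potSSAtThree_of_wAll h).2.1, hcells.2.2.2.2.1, hT, hL,
      hat.2.2, hat.1⟩
  · have hsa := sharpAtoms_of_wAll h
    exact ⟨hps.2.2.2.2.1, hsa.1, hsa.2.1⟩

/-! ### §2. W-ALL from the live routes' targets, the residual leaves and fifteen print facts -/

/-- **Rung W-ALL from the five attacked cells, the named residual leaves, and the fifteen named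
print facts of the Gross–Zagier-primary kernel** (31 + 15 = 46 named hypotheses): if the five live
lane-3 routes close their targets, exactly the other 26 leaves (and nothing unnamed) stand between
the W-ALL books and rung W-ALL, modulo print. [cite: Darmon2004, Thm. 3.22 and §3.9] -/
theorem wAll_of_liveRouteLeaves_primaryGZ
    (h1H : WAllNonCMAtTwoThetaHabitat) (h1O : WAllNonCMAtTwoOffThetaHabitat)
    (hM3 : WAllExclAddPotMultAtThree) (hG3 : WAllExclAddPotOrdAtThree)
    (hS30 : WAllExclAddPotSSAtThreeRankZero) (hT31 : WAllExclAddTameSSAtThreeRankOne)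
    (h2T : WAllExclAddWildRankOneSurjTwin) (h2L : WAllExclAddWildRankOneSurjTwinless)
    (h2N : WAllExclAddWildRankOneIrrNotSurj) (h2R : WAllExclAddWildRankOneRed)
    (h50 : WAllExclAdditiveFiveLeRankZero) (h5S : WAllExclAdditiveFiveLeRankOneSharp)
    (h5O : WAllExclAdditiveFiveLeRankOneOffSharp)
    (h3b : WAllExclX11b) (h3c : WAllExclX2RankOne)
    (h4B : WAllCornerX1RankZeroBalanced) (h4U : WAllCornerX1RankZeroUnbalanced)
    (h41 : X1.RankOne.Statement) (h5 : WAllCornerX2) (h6 : WAllCornerX6r0)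
    (h73 : WAllCornerX7AtThree) (h75 : WAllCornerX7FiveLe)
    (h8 : WAllCornerX8) (h9 : WAllCornerX9) (h10 : WAllCornerX10b) (h11 : WAllCornerX11a)
    (hF2 : WAllCornerFTwo) (hFr : WAllCornerFRamified) (hF3 : WAllCornerFInertBadAtThree)
    (hF5 : WAllCornerFInertBadFiveLe)
    -- the fifteen named print facts of `wAll_of_exclusions_primaryGZ`
    (hSk : Skinner2016.thmC_padicValRat_bsd_rank_zero)
    (hBCS : BurungaleCastellaSkinner2025.cor131_padicValRat_bsd_rank_le_one)
    (hJSW : JetchevSkinnerWan2017.thm121_padicValRat_bsd_rank_one)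
    (hCGS : CastellaGrossiSkinner2025.thmD_padicValRat_bsd_rank_le_one)
    (hGV : GreenbergVatsal2000.thm13_charIdeal_eq_of_gvPar) (hGr : greenberg_charValue_rankZero)
    (hmodP : nonempty_modularParametrizationData)
    (hWa : waldspurger_exists_heegnerField_twist_ne_zero)
    (hMM : murtyMurty_exists_heegnerField_twist_simpleZero)
    (hGZ : ∀ (N : ℕ) [NeZero N] (W : WeierstrassCurve ℚ) (K : Type) [Field K] [NumberField K],
      gross_zagier N W K)
    (hKo : ∀ (N : ℕ) [NeZero N] (W : WeierstrassCurve ℚ) (K : Type) [Field K] [NumberField K],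
      kolyvagin N W K)
    (hCM : bsdTriple_of_hasCM_of_L_one_ne_zero) (hKob : Kobayashi2013.cor14_bsdp_of_cm_rank_one)
    (hYZ : YanZhu2026.thm415_padicValRat_bsd_rank_le_one)
    (hLLT : LiLiuTian2024.thm11_bsdp_of_cm_rank_one) : WAll :=
  wAll_of_exclusions_primaryGZ
    (wAllExclusions_of_liveRouteLeaves h1H h1O hM3 hG3 hS30 hT31 h2T h2L h2N h2R h50 h5S h5O h3b h3c
      h4B h4U h41 h5 h6 h73 h75 h8 h9 h10 h11 hF2 hFr hF3 hF5)
    hSk hBCS hJSW hCGS hGV hGr hmodP hWa hMM hGZ hKo hCM hKob hYZ hLLT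

/-- **The leading-term reading** (`WAllFormula`: the full BSD formula for every `E/ℚ` of analytic
rank `≤ 1`) from the same 46 names plus the one sign binder `hL0`. [cite: Darmon2004, Thm. 3.22 and
§3.9] -/
theorem wAllFormula_of_liveRouteLeaves_primaryGZ
    (h1H : WAllNonCMAtTwoThetaHabitat) (h1O : WAllNonCMAtTwoOffThetaHabitat)
    (hM3 : WAllExclAddPotMultAtThree) (hG3 : WAllExclAddPotOrdAtThree)
    (hS30 : WAllExclAddPotSSAtThreeRankZero) (hT31 : WAllExclAddTameSSAtThreeRankOne)
    (h2T : WAllExclAddWildRankOneSurjTwin) (h2L : WAllExclAddWildRankOneSurjTwinless)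
    (h2N : WAllExclAddWildRankOneIrrNotSurj) (h2R : WAllExclAddWildRankOneRed)
    (h50 : WAllExclAdditiveFiveLeRankZero) (h5S : WAllExclAdditiveFiveLeRankOneSharp)
    (h5O : WAllExclAdditiveFiveLeRankOneOffSharp)
    (h3b : WAllExclX11b) (h3c : WAllExclX2RankOne)
    (h4B : WAllCornerX1RankZeroBalanced) (h4U : WAllCornerX1RankZeroUnbalanced)
    (h41 : X1.RankOne.Statement) (h5 : WAllCornerX2) (h6 : WAllCornerX6r0)
    (h73 : WAllCornerX7AtThree) (h75 : WAllCornerX7FiveLe)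
    (h8 : WAllCornerX8) (h9 : WAllCornerX9) (h10 : WAllCornerX10b) (h11 : WAllCornerX11a)
    (hF2 : WAllCornerFTwo) (hFr : WAllCornerFRamified) (hF3 : WAllCornerFInertBadAtThree)
    (hF5 : WAllCornerFInertBadFiveLe)
    (hSk : Skinner2016.thmC_padicValRat_bsd_rank_zero)
    (hBCS : BurungaleCastellaSkinner2025.cor131_padicValRat_bsd_rank_le_one)
    (hJSW : JetchevSkinnerWan2017.thm121_padicValRat_bsd_rank_one)
    (hCGS : CastellaGrossiSkinner2025.thmD_padicValRat_bsd_rank_le_one)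
    (hGV : GreenbergVatsal2000.thm13_charIdeal_eq_of_gvPar) (hGr : greenberg_charValue_rankZero)
    (hmodP : nonempty_modularParametrizationData)
    (hWa : waldspurger_exists_heegnerField_twist_ne_zero)
    (hMM : murtyMurty_exists_heegnerField_twist_simpleZero)
    (hGZ : ∀ (N : ℕ) [NeZero N] (W : WeierstrassCurve ℚ) (K : Type) [Field K] [NumberField K],
      gross_zagier N W K)
    (hKo : ∀ (N : ℕ) [NeZero N] (W : WeierstrassCurve ℚ) (K : Type) [Field K] [NumberField K],
      kolyvagin N W K)
    (hCM : bsdTriple_of_hasCM_of_L_one_ne_zero) (hKob : Kobayashi2013.cor14_bsdp_of_cm_rank_one)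
    (hYZ : YanZhu2026.thm415_padicValRat_bsd_rank_le_one)
    (hLLT : LiLiuTian2024.thm11_bsdp_of_cm_rank_one)
    (hL0 : re_entireLFunction_one_nonneg) : WAllFormula :=
  wAllFormula_of_exclusions_primaryGZ
    (wAllExclusions_of_liveRouteLeaves h1H h1O hM3 hG3 hS30 hT31 h2T h2L h2N h2R h50 h5S h5O h3b h3c
      h4B h4U h41 h5 h6 h73 h75 h8 h9 h10 h11 hF2 hFr hF3 hF5)
    hSk hBCS hJSW hCGS hGV hGr hmodP hWa hMM hGZ hKo hCM hKob hYZ hLLT hL0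

end Summit.BirchSwinnertonDyer

end
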